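import Literature.AlgebraicGeometry.Motives.FaltingsECSubspacesHom
import Literature.AlgebraicGeometry.Motives.FaltingsECSubspacesConverseProofs
import HarnessLib

/-!
# Faltings 1983, §5: Sätze 3–4 for `E × E'` imply the subspace statement for `E × E'`

Family Hodge (group G16); notions `tate_module`, `cm_endomorphisms_isogeny`. A sibling *proofs*
file (theorems only) of `Literature.AlgebraicGeometry.Motives.FaltingsECSubspacesHom`, which
vendors the named fact `Literature.Hodge.stable_subspace_prod_eq_range_pair W W' ℓ` — every `Γ_K`-stable
`ℚ_ℓ`-subspace of `V_ℓ E × V_ℓ E'` is the image of a map `(a b; c d)` with `a ∈ E_ℓ`,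
`b ∈ H_ℓ(E', E)`, `c ∈ H_ℓ(E, E')`, `d ∈ E'_ℓ` (G. Faltings, Invent. Math. 73 (1983), §5, the step
"`W` is the image of an idempotent in `End_K(A) ⊗_ℤ ℚ_ℓ`" of the proof of Sätze 3–4, for the
abelian surface `A = E × E'` of the proof of Korollar 1) — and derives from it Korollar 1 for
`(E, E')` (`mem_span_range_tateModule_map_of_equivariant_of_pair_facts`). The docstring of that
file asserts that, conversely, the subspace statement is *a consequence of Sätze 3–4 for
`E × E'`* ("Satz 3 gives a `Γ_K`-equivariant projector onto `U`, Satz 4 for `E × E'` places it in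
`End_K(E × E') ⊗ ℚ_ℓ`"), so that the vendored fact is a reformulation of Faltings' theorems for
the pair `E, E'` and not a stronger assertion. This file **proves** that converse, in the
vocabulary of the tree, where Sätze 3–4 for `E × E'` are the named facts of
`Literature.AlgebraicGeometry.Motives.FaltingsEC` for the two factors and the four pairs:

* `Literature.AlgebraicGeometry.Motives.stable_subspace_prod_eq_range_pair_of_faltings`:
  `isSemisimpleRepresentation_rationalGaloisRepTate W ℓ` and `… W' ℓ` (Satz 3 for `E`, `E'`;
  `V_ℓ(E × E') = V_ℓ E ⊕ V_ℓ E'` is then semisimple) together with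
  `mem_span_range_tateModule_map_of_equivariant` for `(E, E)`, `(E, E')`, `(E', E)`, `(E', E')`
  (Satz 4 for `E × E'` = Korollar 1 for the four pairs: `End_K(E × E')` is the `2 × 2` matrix ring
  `(End_K(E), Hom_K(E', E); Hom_K(E, E'), End_K(E'))`) imply
  `stable_subspace_prod_eq_range_pair W W' ℓ`.

This is the analogue for `E × E'` of `stable_subspace_prod_eq_range_of_faltings`
(`FaltingsECSubspacesConverseProofs`, the case `E' = E`), whose general lemmas are reused:
`V_ℓ E × V_ℓ E'` is a semisimple `ℚ_ℓ[Γ_K]`-module (`Literature.AlgebraicGeometry.Motives.isSemisimpleRepresentation_prod`), so a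
stable `U` is the image of a `Γ_K`-equivariant projector `P` (`Literature.AlgebraicGeometry.Motives.exists_equivariant_range_eq`);
its entries `pr_i ∘ P ∘ ι_j` intertwine the `Γ_K`-actions, hence lie in `E_ℓ`, `H_ℓ(E', E)`,
`H_ℓ(E, E')`, `E'_ℓ` by the `ℚ_ℓ`-forms of Satz 4 / Korollar 1
(`mem_rationalEndSpan_of_equivariant` of the sibling file; `mem_rationalHomSpan_of_equivariant`
here, by clearing denominators in `Hom(V_ℓ E, V_ℓ E') = ℚ_ℓ ⊗ Hom(T_ℓ E, T_ℓ E')`,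
`Literature.AlgebraicGeometry.Motives.exists_smul_eq_baseChange_hom`, `T_ℓ E` being finite free over `ℤ_ℓ` by the tree's
`module_free_tateModule_holds` / `module_finite_tateModule_holds`).

## Contents (all proved; no definitions)

* `Literature.AlgebraicGeometry.Motives.exists_smul_eq_baseChange_hom`: for `M` finite free over `ℤ_ℓ` and any `N`, every
  `G ∈ Hom_{ℚ_ℓ}(ℚ_ℓ ⊗ M, ℚ_ℓ ⊗ N)` has `b G = 1 ⊗ g` for some `b ∈ ℤ_ℓ ∖ {0}`, `g ∈ Hom(M, N)` (the
  two-module form of `Literature.AlgebraicGeometry.Motives.exists_smul_eq_baseChange`).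
* `Literature.AlgebraicGeometry.Motives.baseChange_mem_rationalHomSpan`, `Literature.AlgebraicGeometry.Motives.mem_rationalHomSpan_of_equivariant`,
  `Literature.AlgebraicGeometry.Motives.mem_rationalHomSpan_iff`: granted Korollar 1 for `(E, E')`,
  `H_ℓ(E, E') = Hom_{Γ_K}(V_ℓ E, V_ℓ E')`.
* `Literature.AlgebraicGeometry.Motives.stable_subspace_prod_eq_range_pair_of_faltings`: the target.

## References

* [Faltings1983Endlichkeit] G. Faltings, *Endlichkeitssätze für abelsche Varietäten über
  Zahlkörpern*, Invent. Math. 73 (1983), 349–366, §5, Satz 3, Satz 4, Korollar 1 and the proof of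
  Sätze 3–4; Engl. transl. [Faltings1986FinitenessTranslation] in Cornell–Silverman (eds.),
  *Arithmetic Geometry*, Springer 1986, Ch. II, §5, Theorems 3–4, Corollary 1 (pp. 17–18 of the
  chapter).
* [Tate1966Endomorphisms] J. Tate, *Endomorphisms of abelian varieties over finite fields*,
  Invent. Math. 2 (1966), 134–144, §1, Lemma 1 ff. (the passage between `T_ℓ` and `V_ℓ`).

## Design

`noncomputable section`; the general lemma in `namespace Literature`, the elliptic-curve statements in
`namespace Literature.Hodge` with the conventions of `FaltingsECSubspacesHom` (`K : Type u`, hypothesis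
instances `[NumberField K] [W.IsElliptic] [W'.IsElliptic]` introduced where the named facts
quantify them). Satz 4 for `E × E'` enters as Korollar 1 for the four pairs, all instances of the
one named fact `mem_span_range_tateModule_map_of_equivariant`; the diagonal ones are converted to
the `End` form by the tree's `mem_span_range_tateEndRingHom_iff_of_hom`. No statement of the tree
is modified; the file only adds theorems.
-/

noncomputable section

open scoped TensorProduct

universe u

/-! ## Clearing denominators in `Hom(ℚ_ℓ ⊗ M, ℚ_ℓ ⊗ N)` for `M` finite free over `ℤ_ℓ` -/

namespace Literature.AlgebraicGeometry.Motives

section ClearDenominators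

variable (ℓ : ℕ) [Fact ℓ.Prime] {M N : Type*} [AddCommGroup M] [Module ℤ_[ℓ] M] [AddCommGroup N]
  [Module ℤ_[ℓ] N]

/-- For a finite free `ℤ_ℓ`-module `M` and a `ℤ_ℓ`-module `N`, every `ℚ_ℓ`-linear map
`G : ℚ_ℓ ⊗ M → ℚ_ℓ ⊗ N` has a non-zero multiple `b G`, `b ∈ ℤ_ℓ`, which is the base change of a
`ℤ_ℓ`-linear map `M → N` (`Hom(ℚ_ℓ ⊗ M, ℚ_ℓ ⊗ N) = ℚ_ℓ ⊗ Hom(M, N)`: clear the denominators of the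
images of a basis of `M`). The case `N = M` is `Literature.AlgebraicGeometry.Motives.exists_smul_eq_baseChange`. [folklore] -/
theorem exists_smul_eq_baseChange_hom [Module.Free ℤ_[ℓ] M] [Module.Finite ℤ_[ℓ] M]
    (G : ℚ_[ℓ] ⊗[ℤ_[ℓ]] M →ₗ[ℚ_[ℓ]] ℚ_[ℓ] ⊗[ℤ_[ℓ]] N) :
    ∃ b : ℤ_[ℓ], b ≠ 0 ∧ ∃ g : M →ₗ[ℤ_[ℓ]] N, (b : ℚ_[ℓ]) • G = g.baseChange ℚ_[ℓ] := by
  classical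
  let bs := Module.finBasis ℤ_[ℓ] M
  have hsurj := fun i ↦ IsLocalizedModule.surj (nonZeroDivisors ℤ_[ℓ])
    (TensorProduct.mk ℤ_[ℓ] ℚ_[ℓ] N 1) (G (1 ⊗ₜ bs i))
  choose y hy using hsurj
  set s : Fin (Module.finrank ℤ_[ℓ] M) → ℤ_[ℓ] := fun i ↦ ((y i).2 : ℤ_[ℓ]) with hs
  have hs0 : ∀ i, s i ≠ 0 := fun i ↦ nonZeroDivisors.coe_ne_zero _
  set b' : Fin (Module.finrank ℤ_[ℓ] M) → ℤ_[ℓ] := fun i ↦ ∏ j ∈ Finset.univ.erase i, s j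
    with hb'
  refine ⟨∏ i, s i, Finset.prod_ne_zero_iff.mpr fun i _ ↦ hs0 i,
    bs.constr ℤ_[ℓ] fun i ↦ b' i • (y i).1, ?_⟩
  have hbb : ∀ i, ∏ j, s j = b' i * s i := fun i ↦
    (Finset.prod_erase_mul Finset.univ s (Finset.mem_univ i)).symm
  -- reduce to the generators `1 ⊗ bs i`
  have key : ∀ m : M, ((∏ i, s i : ℤ_[ℓ]) : ℚ_[ℓ]) • G (1 ⊗ₜ m) =
      (1 : ℚ_[ℓ]) ⊗ₜ[ℤ_[ℓ]] (bs.constr ℤ_[ℓ] (fun i ↦ b' i • (y i).1) m) := by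
    intro m
    suffices h : (((∏ i, s i : ℤ_[ℓ]) : ℚ_[ℓ]) • G).restrictScalars ℤ_[ℓ] ∘ₗ
        TensorProduct.mk ℤ_[ℓ] ℚ_[ℓ] M 1 =
        TensorProduct.mk ℤ_[ℓ] ℚ_[ℓ] N 1 ∘ₗ bs.constr ℤ_[ℓ] (fun i ↦ b' i • (y i).1) from
      LinearMap.congr_fun h m
    refine bs.ext fun i ↦ ?_
    simp only [LinearMap.coe_comp, Function.comp_apply, TensorProduct.mk_apply,
      LinearMap.coe_restrictScalars, LinearMap.smul_apply, Module.Basis.constr_basis]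
    have hyi : ((s i : ℤ_[ℓ]) : ℚ_[ℓ]) • G (1 ⊗ₜ bs i) = (1 : ℚ_[ℓ]) ⊗ₜ[ℤ_[ℓ]] (y i).1 := by
      have h := hy i
      rw [Submonoid.smul_def, TensorProduct.mk_apply] at h
      rw [← h]
      exact algebraMap_smul ℚ_[ℓ] (s i) _
    rw [hbb i, PadicInt.coe_mul, mul_smul, hyi, TensorProduct.tmul_smul]
    exact algebraMap_smul ℚ_[ℓ] (b' i) _
  refine TensorProduct.AlgebraTensorModule.ext fun q m ↦ ?_
  rw [LinearMap.baseChange_tmul, LinearMap.smul_apply]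
  have hq : q ⊗ₜ[ℤ_[ℓ]] m = q • ((1 : ℚ_[ℓ]) ⊗ₜ[ℤ_[ℓ]] m) := by
    rw [TensorProduct.smul_tmul', smul_eq_mul, mul_one]
  rw [hq, map_smul, smul_comm, key m, TensorProduct.smul_tmul', smul_eq_mul, mul_one]

end ClearDenominators

end Literature.AlgebraicGeometry.Motives

namespace Literature.AlgebraicGeometry.Motives

open WeierstrassCurve

variable {K : Type u} [Field K] (W W' : WeierstrassCurve K) (ℓ : ℕ) [Fact ℓ.Prime]

/-! ## `Hom_{Γ_K}(V_ℓ E, V_ℓ E') ⊆ H_ℓ(E, E')` from Korollar 1 -/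

/-- Base change `Hom(T_ℓ E, T_ℓ E') → Hom(V_ℓ E, V_ℓ E')`, `g ↦ 1 ⊗ g`, carries `ℤ_ℓ · {T_ℓ φ}` into
`H_ℓ(E, E') = ℚ_ℓ · {1 ⊗ T_ℓ φ}` (it is additive and `ℤ_ℓ`-linear). [folklore] -/
theorem baseChange_mem_rationalHomSpan {g : W.tateModule ℓ →ₗ[ℤ_[ℓ]] W'.tateModule ℓ}
    (hg : g ∈ Submodule.span ℤ_[ℓ]
      (Set.range fun φ : Isogeny W W' ↦ Literature.NumberTheory.EllipticCurves.TateModule.map ℓ φ.toAddMonoidHom)) :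
    (g.baseChange ℚ_[ℓ] : W.rationalTateModule ℓ →ₗ[ℚ_[ℓ]] W'.rationalTateModule ℓ) ∈
      rationalHomSpan W W' ℓ := by
  induction hg using Submodule.span_induction with
  | mem f hf =>
    obtain ⟨φ, rfl⟩ := hf
    exact baseChange_tateModule_map_mem_rationalHomSpan ℓ φ
  | zero =>
    rw [LinearMap.baseChange_zero]
    exact (rationalHomSpan W W' ℓ).zero_mem
  | add f f' _ _ hf hf' =>
    rw [LinearMap.baseChange_add]
    exact (rationalHomSpan W W' ℓ).add_mem hf hf'
  | smul c f _ hf =>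
    rw [LinearMap.baseChange_smul]
    exact (rationalHomSpan W W' ℓ).smul_of_tower_mem c hf

/-- **The `ℚ_ℓ`-form of Korollar 1 from its `ℤ_ℓ`-form.** Granted the named fact
`mem_span_range_tateModule_map_of_equivariant W W' ℓ` (Faltings 1983, Satz 4, Korollar 1 for
`(E, E')`: every `Γ_K`-equivariant `ℤ_ℓ`-linear `T_ℓ E → T_ℓ E'` lies in `ℤ_ℓ · {T_ℓ φ}`), every
`Γ_K`-equivariant `ℚ_ℓ`-linear map `G : V_ℓ E → V_ℓ E'` lies in
`H_ℓ(E, E') = image(Hom_K(E, E') ⊗ ℚ_ℓ)`: `T_ℓ E` is finite free over `ℤ_ℓ`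
(`module_free_tateModule_holds`, `module_finite_tateModule_holds`), so `b G = 1 ⊗ g` for some
`b ≠ 0` and `g ∈ Hom(T_ℓ E, T_ℓ E')` (`Literature.AlgebraicGeometry.Motives.exists_smul_eq_baseChange_hom`); `g` is equivariant
because base change `Hom(T_ℓ E, T_ℓ E') → Hom(V_ℓ E, V_ℓ E')` is injective (`T_ℓ E'` is flat over
`ℤ_ℓ`), so `g ∈ ℤ_ℓ · {T_ℓ φ}` and `G = b⁻¹ (1 ⊗ g) ∈ H_ℓ(E, E')`. Faltings, §5, Korollar 1
tensored with `ℚ_ℓ` (the converse bookkeeping of "it suffices to prove the `ℚ_ℓ`-statement").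
[cite: Faltings1983Endlichkeit, §5, Satz 4, Korollar 1] -/
theorem mem_rationalHomSpan_of_equivariant (hK : mem_span_range_tateModule_map_of_equivariant W W' ℓ)
    [NumberField K] [W.IsElliptic] [W'.IsElliptic]
    {G : W.rationalTateModule ℓ →ₗ[ℚ_[ℓ]] W'.rationalTateModule ℓ}
    (hG : ∀ (σ : Field.absoluteGaloisGroup K) (v : W.rationalTateModule ℓ),
      G (rationalGaloisRepTate W ℓ σ v) = rationalGaloisRepTate W' ℓ σ (G v)) :
    G ∈ rationalHomSpan W W' ℓ := by
  haveI : Module.Free ℤ_[ℓ] (W.tateModule ℓ) := module_free_tateModule_holds W ℓ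
  haveI : Module.Finite ℤ_[ℓ] (W.tateModule ℓ) := module_finite_tateModule_holds W ℓ
  obtain ⟨b, hb, g, hbG⟩ :=
    exists_smul_eq_baseChange_hom ℓ (M := W.tateModule ℓ) (N := W'.tateModule ℓ) G
  have hGc : ∀ σ : Field.absoluteGaloisGroup K,
      G ∘ₗ (galoisRepTate W ℓ σ).baseChange ℚ_[ℓ] =
        (galoisRepTate W' ℓ σ).baseChange ℚ_[ℓ] ∘ₗ G :=
    fun σ ↦ LinearMap.ext fun v ↦ hG σ v
  have hg : ∀ (σ : Field.absoluteGaloisGroup K) (x : W.tateModule ℓ), g (σ • x) = σ • g x := by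
    intro σ
    have key : g ∘ₗ galoisRepTate W ℓ σ = galoisRepTate W' ℓ σ ∘ₗ g := by
      apply LinearMap.baseChangeHom_injective ℤ_[ℓ] (W.tateModule ℓ) ℚ_[ℓ]
      simp only [LinearMap.baseChangeHom_apply, LinearMap.baseChange_comp]
      rw [← hbG, LinearMap.smul_comp, LinearMap.comp_smul]
      exact congrArg ((b : ℚ_[ℓ]) • ·) (hGc σ)
    intro x
    exact LinearMap.congr_fun key x
  have hmem : (g.baseChange ℚ_[ℓ] : W.rationalTateModule ℓ →ₗ[ℚ_[ℓ]] W'.rationalTateModule ℓ) ∈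
      rationalHomSpan W W' ℓ := baseChange_mem_rationalHomSpan W W' ℓ (hK g hg)
  rw [← hbG] at hmem
  have hb' : (b : ℚ_[ℓ]) ≠ 0 := PadicInt.coe_ne_zero.mpr hb
  exact (Submodule.smul_mem_iff _ hb').mp hmem

/-- **`H_ℓ(E, E') = Hom_{Γ_K}(V_ℓ E, V_ℓ E')`** granted Korollar 1 for `(E, E')` (the named fact
`mem_span_range_tateModule_map_of_equivariant W W' ℓ`): a `ℚ_ℓ`-linear map `V_ℓ E → V_ℓ E'` lies in
`H_ℓ(E, E') = image(Hom_K(E, E') ⊗ ℚ_ℓ)` iff it intertwines the `Γ_K`-actions (the easy direction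
is `apply_rationalGaloisRepTate_of_mem_rationalHomSpan`). Faltings, §5, Korollar 1:
`Hom_K(A₁, A₂) ⊗ ℚ_ℓ → Hom_π(V_ℓ(A₁), V_ℓ(A₂))` is bijective.
[cite: Faltings1983Endlichkeit, §5, Satz 4, Korollar 1] -/
theorem mem_rationalHomSpan_iff (hK : mem_span_range_tateModule_map_of_equivariant W W' ℓ)
    [NumberField K] [W.IsElliptic] [W'.IsElliptic]
    (G : W.rationalTateModule ℓ →ₗ[ℚ_[ℓ]] W'.rationalTateModule ℓ) :
    G ∈ rationalHomSpan W W' ℓ ↔ ∀ (σ : Field.absoluteGaloisGroup K) (v : W.rationalTateModule ℓ),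
      G (rationalGaloisRepTate W ℓ σ v) = rationalGaloisRepTate W' ℓ σ (G v) :=
  ⟨fun hG σ v ↦ apply_rationalGaloisRepTate_of_mem_rationalHomSpan W W' ℓ hG σ v,
    fun hG ↦ mem_rationalHomSpan_of_equivariant W W' ℓ hK hG⟩

/-! ## Sätze 3–4 for `E × E'` imply the subspace statement for `E × E'` -/

/-- **The subspace statement for `E × E'` from Sätze 3–4 for `E × E'`.** For Weierstrass curves
`W, W'` over `K` and a prime `ℓ`, the named facts
`isSemisimpleRepresentation_rationalGaloisRepTate W ℓ`, `… W' ℓ` (Faltings 1983, Satz 3 for `E`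
and `E'`: `V_ℓ E`, `V_ℓ E'` are semisimple `Γ_K`-modules, hence so is
`V_ℓ(E × E') = V_ℓ E ⊕ V_ℓ E'`) and `mem_span_range_tateModule_map_of_equivariant` for the four pairs
`(E, E)`, `(E, E')`, `(E', E)`, `(E', E')` (Satz 4 with Korollar 1: surjectivity of
`Hom_K ⊗ ℤ_ℓ → Hom_{Γ_K}(T_ℓ, T_ℓ)`, i.e. Satz 4 for `E × E'` read through the matrix ring
`End_K(E × E') = (End_K(E), Hom_K(E', E); Hom_K(E, E'), End_K(E'))`) imply the named fact
`stable_subspace_prod_eq_range_pair W W' ℓ` (for `E, E'` elliptic over the number field `K`, every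
`Γ_K`-stable `ℚ_ℓ`-subspace `U ⊆ V_ℓ E × V_ℓ E'` is the image of `(a b; c d)` with `a ∈ E_ℓ`,
`b ∈ H_ℓ(E', E)`, `c ∈ H_ℓ(E, E')`, `d ∈ E'_ℓ`): `V_ℓ E × V_ℓ E'` is semisimple
(`Literature.AlgebraicGeometry.Motives.isSemisimpleRepresentation_prod`), so `U` is the image of a `Γ_K`-equivariant projector `P`
(`Literature.AlgebraicGeometry.Motives.exists_equivariant_range_eq`); the entries `a = pr₁ ∘ P ∘ ι₁`, `b = pr₁ ∘ P ∘ ι₂`,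
`c = pr₂ ∘ P ∘ ι₁`, `d = pr₂ ∘ P ∘ ι₂` intertwine the `Γ_K`-actions, hence lie in `E_ℓ`,
`H_ℓ(E', E)`, `H_ℓ(E, E')`, `E'_ℓ` (`mem_rationalEndSpan_of_equivariant` with
`mem_span_range_tateEndRingHom_iff_of_hom`; `mem_rationalHomSpan_of_equivariant`), and
`P = (a b; c d)`. Together with `mem_span_range_tateModule_map_of_equivariant_of_pair_facts` (the
converse deduction, granted the elementary named facts `geomEndRing_comm`, `Isogeny.exists_dual`,
`Isogeny.exists_eq_comp_nsmul_of_geomTorsion_le_ker`) this shows that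
`stable_subspace_prod_eq_range_pair W W' ℓ` is a reformulation of Faltings' Sätze 3–4 with
Korollar 1 for the pair `E, E'`, as asserted in the docstring of `FaltingsECSubspacesHom`.
[cite: Faltings1983Endlichkeit, §5, Sätze 3–4 and Korollar 1 (for A₁ × A₂ = E × E')] -/
theorem stable_subspace_prod_eq_range_pair_of_faltings
    (h3 : isSemisimpleRepresentation_rationalGaloisRepTate W ℓ)
    (h3' : isSemisimpleRepresentation_rationalGaloisRepTate W' ℓ)
    (hEE : mem_span_range_tateModule_map_of_equivariant W W ℓ)
    (hEE' : mem_span_range_tateModule_map_of_equivariant W W' ℓ)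
    (hE'E : mem_span_range_tateModule_map_of_equivariant W' W ℓ)
    (hE'E' : mem_span_range_tateModule_map_of_equivariant W' W' ℓ) :
    stable_subspace_prod_eq_range_pair W W' ℓ := by
  intro _ _ _ U hU
  set ρ := rationalGaloisRepTate W ℓ with hρ
  set ρ' := rationalGaloisRepTate W' ℓ with hρ'
  have hss : (ρ.prod ρ').IsSemisimpleRepresentation := isSemisimpleRepresentation_prod h3 h3'
  obtain ⟨P, hP, hPU⟩ := exists_equivariant_range_eq hss U (fun σ v hv ↦ hU σ v hv)
  let a : Module.End ℚ_[ℓ] (W.rationalTateModule ℓ) :=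
    LinearMap.fst _ _ _ ∘ₗ P ∘ₗ LinearMap.inl _ _ _
  let b : W'.rationalTateModule ℓ →ₗ[ℚ_[ℓ]] W.rationalTateModule ℓ :=
    LinearMap.fst _ _ _ ∘ₗ P ∘ₗ LinearMap.inr _ _ _
  let c : W.rationalTateModule ℓ →ₗ[ℚ_[ℓ]] W'.rationalTateModule ℓ :=
    LinearMap.snd _ _ _ ∘ₗ P ∘ₗ LinearMap.inl _ _ _
  let d : Module.End ℚ_[ℓ] (W'.rationalTateModule ℓ) :=
    LinearMap.snd _ _ _ ∘ₗ P ∘ₗ LinearMap.inr _ _ _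
  have hPe : P = (a.coprod b).prod (c.coprod d) := by
    apply LinearMap.ext
    rintro ⟨x, y⟩
    have hxy : (x, y) = LinearMap.inl ℚ_[ℓ] _ _ x + LinearMap.inr ℚ_[ℓ] _ _ y := by simp
    rw [hxy, map_add]
    ext <;> simp [a, b, c, d]
  have h1 : ∀ (σ : Field.absoluteGaloisGroup K) (x : W.rationalTateModule ℓ),
      (ρ.prod ρ') σ (x, 0) = (ρ σ x, 0) := fun σ x ↦ by simp [Representation.prod]
  have h2 : ∀ (σ : Field.absoluteGaloisGroup K) (y : W'.rationalTateModule ℓ),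
      (ρ.prod ρ') σ (0, y) = (0, ρ' σ y) := fun σ y ↦ by simp [Representation.prod]
  have hfst : ∀ (σ : Field.absoluteGaloisGroup K)
      (v : W.rationalTateModule ℓ × W'.rationalTateModule ℓ),
      ((ρ.prod ρ') σ v).1 = ρ σ v.1 := fun σ v ↦ by simp [Representation.prod]
  have hsnd : ∀ (σ : Field.absoluteGaloisGroup K)
      (v : W.rationalTateModule ℓ × W'.rationalTateModule ℓ),
      ((ρ.prod ρ') σ v).2 = ρ' σ v.2 := fun σ v ↦ by simp [Representation.prod]
  have ha : a ∈ rationalEndSpan W ℓ := by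
    refine mem_rationalEndSpan_of_equivariant W ℓ (mem_span_range_tateEndRingHom_iff_of_hom W ℓ hEE)
      fun σ x ↦ ?_
    change (P (ρ σ x, 0)).1 = ρ σ (P (x, 0)).1
    rw [← h1, hP, hfst]
  have hb : b ∈ rationalHomSpan W' W ℓ := by
    refine mem_rationalHomSpan_of_equivariant W' W ℓ hE'E fun σ y ↦ ?_
    change (P (0, ρ' σ y)).1 = ρ σ (P (0, y)).1
    rw [← h2, hP, hfst]
  have hc : c ∈ rationalHomSpan W W' ℓ := by
    refine mem_rationalHomSpan_of_equivariant W W' ℓ hEE' fun σ x ↦ ?_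
    change (P (ρ σ x, 0)).2 = ρ' σ (P (x, 0)).2
    rw [← h1, hP, hsnd]
  have hd : d ∈ rationalEndSpan W' ℓ := by
    refine mem_rationalEndSpan_of_equivariant W' ℓ
      (mem_span_range_tateEndRingHom_iff_of_hom W' ℓ hE'E') fun σ y ↦ ?_
    change (P (0, ρ' σ y)).2 = ρ' σ (P (0, y)).2
    rw [← h2, hP, hsnd]
  exact ⟨a, b, c, d, ha, hb, hc, hd, by rw [← hPe, hPU]⟩

end Literature.AlgebraicGeometry.Motives
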